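import Mathlib
import HarnessLib
import Summits.Ventures.LatticeQCDFlow.Exactness.SphereFamilyLeapfrogHMC
import Summits.Ventures.LatticeQCDFlow.Exactness.SphereExpMapMinorisation
import Summits.Ventures.LatticeQCDFlow.Exactness.LeapfrogHMCDoeblin

/-!
# Single-step geodesic leapfrog HMC on a family of spheres (the `cpn_2d.HMCCPN` phase space) is Doeblin in ONE step, hence uniformly ergodic

HONEST FRAMING: exact (Metropolis-corrected) sampling algorithms for lattice gauge theory;
figures of merit are autocorrelation/cost numbers at stated couplings and volumes; no
continuum-physics claim.

Venture `LatticeQCDFlow` (cell pub-lqcd), topic `Exactness`, FANOUT row 9 (eng-latcore, the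
engine `latflow.core.cpn_2d.HMCCPN.trajectory(τ, nstep = 1)`).  NEW WORK of the cell over Mathlib
and the tree: parts 1a/1b `SphereFamilyLeapfrog.lean` / `SphereFamilyLeapfrogHMC.lean` (the kernel
`famLeapfrogHMC F δ n hF S`, exact for `e^{−S} · ⊗ uniformSphere`), part 2b
`SphereExpMapMinorisation.lean` (**`smul_uniformSphere_le_map_spherePos`**: one geodesic step from a
ball-uniform ambient momentum with any bounded shift dominates `sphereExpConst • uniformSphere`
from every point), row 9's `LeapfrogHMCDoeblin.lean` (`refreshUpdate_involMH_minorised`,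
`le_involAcceptE_of_le`, `smul_pi_le_pi`, `refreshUpdate_involMH_uniformlyErgodic`,
`refreshUpdate_involMH_invariant_unique`) and row 7's `SphereDriftLift.lean` (the drift carries the
normal component and conserves the tangential speed).  Nothing is cited as a fact.  Printed
counterparts, NAMED ONLY: Duane–Kennedy–Pendleton–Roweth 1987; Engel–Schaefer 2011 §2.2;
Meyn–Tweedie ch. 16 (Doeblin ⇒ uniform ergodicity); Mackenzie 1989 (why only `nstep = 1`).

Part 3 of the gen-16 chain.  WHAT IS PROVED (indices `ι` finite, dimensions `k : ι → ℕ`, variable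
`i` on `S^{k i+1} ⊂ ℝ^{k i+2}`; step `δ > 0`; ANY measurable coupled force field `F` with
`‖F x i‖ ≤ b`; ANY measurable action `S` with `|S| ≤ s` — e.g. any continuous action on the compact
configuration space):

* §1 `norm_snd_ambientDrift` (the drift preserves `‖p‖`), `famProposal_one_apply`,
  `fst_famProposal_one` (the proposed configuration is `i ↦ spherePos δ (x i) (p i + ½δ F x i)` —
  ONE geodesic step of the half-kicked momentum, index by index), `norm_snd_famProposal_one_le`
  (`‖p''_i‖ ≤ ‖p_i‖ + δ b`).
* §2 `famMomBox`, `smul_restrict_famMomBox_le_famMomentumLaw` (the Gaussian refresh dominates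
  `Z⁻¹e^{−|ι|R²/2} ·` Lebesgue on the box `‖p_i‖ < R`), `famLeapfrog_energy_window`
  (`H(Ψ(x,p)) ≤ H(x,p) + 2s + |ι|(R + δb)²/2` on the box), `smul_pi_uniformSphere_le_map_famProposal`
  (with `R = π/δ + δb/2 + 1`: the proposed configuration, `p` box-uniform, dominates
  `(∏ᵢ sphereExpConst (k i) δ) • ⊗ uniformSphere` from EVERY `x` — index by index, `smul_pi_le_pi`);
  **`famLeapfrogHMC_minorised`** — DOEBLIN: `∃ η > 0, ∀ x, K(x, ·) ≥ η • ⊗ uniformSphere`.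
* §3 `isProbabilityMeasure_famGibbsLaw`; **`famLeapfrogHMC_uniformlyErgodic`** — `∃ η ∈ (0, 1]`:
  `|μ₀Kᵗ(A) − π_S(A)| ≤ (1 − η)ᵗ` for EVERY initial law `μ₀`, every `t`, every set `A`,
  `π_S = famGibbsLaw S = Z_S⁻¹ e^{−S} · ⊗ uniformSphere`; **`famLeapfrogHMC_invariant_unique`** — `π_S`
  is the ONLY invariant probability law.

NOT CLAIMED: `nstep ≥ 2` (two geodesic steps compose; fixed-length trajectories can be
non-ergodic, Mackenzie 1989); any useful RATE (`η` is `e^{−B} · Z⁻¹e^{−|ι|R²/2} · ∏ 2δ^{−(kᵢ+1)}|S^{kᵢ+1}|`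
-sized); floating point; the CP(N−1) instance (part 4).
-/

noncomputable section

namespace Summit.Ventures.LatticeQCDFlow.Exactness

open MeasureTheory Measure Metric Set Real ProbabilityTheory
open scoped ENNReal InnerProductSpace

/-! ## §1 One leapfrog step, index by index -/

section OneSphere

variable {m : Type*} [Fintype m] [DecidableEq m]

omit [DecidableEq m] in
/-- **The geodesic drift with ambient momenta preserves the length of the momentum** (tangential
speed and normal component are both conserved). -/
theorem norm_snd_ambientDrift (t : ℝ) (z : sphere (0 : EuclideanSpace ℝ m) 1 × EuclideanSpace ℝ m) :
    ‖(ambientDrift t z).2‖ = ‖z.2‖ := by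
  have hx : ‖(z.1 : EuclideanSpace ℝ m)‖ = 1 := norm_eq_of_mem_sphere z.1
  have h : ‖(ambientDrift t z).2‖ ^ 2 = ‖z.2‖ ^ 2 := by
    rw [norm_sq_eq_tangential_add_normal (ambientDrift t z), tangentialPart_ambientDrift, inner_ambientDrift,
      norm_snd_geodesicDrift (τ := t) hx (inner_tangentialPart z), ← norm_sq_eq_tangential_add_normal z]
  exact (sq_eq_sq₀ (norm_nonneg _) (norm_nonneg _)).1 h

end OneSphere

section Family

variable {ι : Type*} [Fintype ι] {k : ι → ℕ}
  {F : (Π i, FamS k i) → (Π i, FamE k i)} {δ : ℝ}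

omit [Fintype ι] in
/-- **One leapfrog step then the flip, pointwise**: half kick, drift, half kick, flip. -/
theorem famProposal_one_apply (F : (Π i, FamS k i) → (Π i, FamE k i)) (δ : ℝ)
    (z : (Π i, FamS k i) × (Π i, FamE k i)) :
    famProposal F δ 1 z = famFlip (famKick F (δ / 2) (famDrift δ (famKick F (δ / 2) z))) := by
  rw [famProposal, pow_one, famLeapfrogPerm]
  rfl

omit [Fintype ι] in
/-- **The proposed configuration of the one-step leapfrog is, index by index, ONE geodesic step of
the half-kicked momentum**: `(Ψ(x, p)).1 i = spherePos δ (x i) (p i + ½δ F x i)`. -/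
theorem fst_famProposal_one (F : (Π i, FamS k i) → (Π i, FamE k i)) (δ : ℝ) (x : Π i, FamS k i)
    (p : Π i, FamE k i) (i : ι) :
    (famProposal F δ 1 (x, p)).1 i = spherePos δ (x i) (p i + (δ / 2) • F x i) := by
  rw [famProposal_one_apply]
  rfl

omit [Fintype ι] in
/-- **The final momentum is at most `δ b` longer than the initial one** (two half kicks of size
`½δ‖F‖ ≤ ½δb`; the drift preserves the length). -/
theorem norm_snd_famProposal_one_le {b : ℝ} (hb : ∀ x i, ‖F x i‖ ≤ b) (δ : ℝ) (x : Π i, FamS k i)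
    (p : Π i, FamE k i) (i : ι) :
    ‖(famProposal F δ 1 (x, p)).2 i‖ ≤ ‖p i‖ + |δ| * b := by
  rw [famProposal_one_apply]
  change ‖(-((famDrift δ (famKick F (δ / 2) (x, p))).2 +
      (δ / 2) • F (famDrift δ (famKick F (δ / 2) (x, p))).1)) i‖ ≤ _
  rw [Pi.neg_apply, norm_neg, Pi.add_apply, Pi.smul_apply]
  have h2 : ‖(famDrift δ (famKick F (δ / 2) (x, p))).2 i‖ = ‖p i + (δ / 2) • F x i‖ := by
    change ‖(ambientDrift δ (x i, p i + (δ / 2) • F x i)).2‖ = _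
    exact norm_snd_ambientDrift δ _
  have hhalf : ∀ (y : Π i, FamS k i), ‖(δ / 2) • F y i‖ ≤ |δ| / 2 * b := fun y => by
    rw [norm_smul, Real.norm_eq_abs, abs_div, abs_two]
    exact mul_le_mul_of_nonneg_left (hb y i) (by positivity)
  calc ‖(famDrift δ (famKick F (δ / 2) (x, p))).2 i + (δ / 2) • F (famDrift δ (famKick F (δ / 2) (x, p))).1 i‖
      ≤ ‖(famDrift δ (famKick F (δ / 2) (x, p))).2 i‖ + ‖(δ / 2) • F (famDrift δ (famKick F (δ / 2) (x, p))).1 i‖ :=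
        norm_add_le _ _
    _ ≤ (‖p i‖ + |δ| / 2 * b) + |δ| / 2 * b := by
        rw [h2]
        exact add_le_add ((norm_add_le _ _).trans (add_le_add le_rfl (hhalf x))) (hhalf _)
    _ = ‖p i‖ + |δ| * b := by ring

/-! ## §2 Doeblin: the kernel dominates a multiple of `⊗ uniformSphere` from every configuration -/

/-- The momentum box `‖p_i‖ < R` for every index. -/
def famMomBox (k : ι → ℕ) (R : ℝ) : Set (Π i, FamE k i) := Set.pi univ fun i => ball (0 : FamE k i) R

/-- The momentum box is measurable. -/
theorem measurableSet_famMomBox (R : ℝ) : MeasurableSet (famMomBox k R) :=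
  MeasurableSet.univ_pi fun _ => measurableSet_ball

omit [Fintype ι] in
/-- Inside the box every component is shorter than `R`. -/
theorem norm_le_of_mem_famMomBox {R : ℝ} {p : Π i, FamE k i} (hp : p ∈ famMomBox k R) (i : ι) :
    ‖p i‖ ≤ R :=
  (mem_ball_zero_iff.1 (hp i (mem_univ i))).le

/-- **The Gaussian refresh dominates a multiple of Lebesgue measure on the box**:
`Z⁻¹ e^{−|ι|R²/2} · ⊗dp|_{box R} ≤ Z⁻¹ e^{−T} ⊗dp`. -/
theorem smul_restrict_famMomBox_le_famMomentumLaw (R : ℝ) :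
    ((famMomentumWeight k univ)⁻¹ * ENNReal.ofReal (Real.exp (-(Fintype.card ι * R ^ 2 / 2)))) •
        (Measure.pi fun i => (volume : Measure (FamE k i))).restrict (famMomBox k R) ≤
      famMomentumLaw k := by
  rw [famMomentumLaw, mul_smul]
  have hinner : ENNReal.ofReal (Real.exp (-(Fintype.card ι * R ^ 2 / 2))) •
      (Measure.pi fun i => (volume : Measure (FamE k i))).restrict (famMomBox k R) ≤ famMomentumWeight k := by
    rw [← withDensity_const, famMomentumWeight]
    calc ((Measure.pi fun i => (volume : Measure (FamE k i))).restrict (famMomBox k R)).withDensity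
          (fun _ => ENNReal.ofReal (Real.exp (-(Fintype.card ι * R ^ 2 / 2))))
        ≤ ((Measure.pi fun i => (volume : Measure (FamE k i))).restrict (famMomBox k R)).withDensity
            fun p => ENNReal.ofReal (Real.exp (-famKinetic p)) := by
          refine withDensity_mono ((ae_restrict_iff' (measurableSet_famMomBox R)).2
            (Filter.Eventually.of_forall fun p hp => ?_))
          exact ENNReal.ofReal_le_ofReal (Real.exp_le_exp.2 (neg_le_neg
            (famKinetic_le_of_norm_le (norm_le_of_mem_famMomBox hp))))
      _ = ((Measure.pi fun i => (volume : Measure (FamE k i))).withDensity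
            fun p => ENNReal.ofReal (Real.exp (-famKinetic p))).restrict (famMomBox k R) :=
          (restrict_withDensity (measurableSet_famMomBox R) _).symm
      _ ≤ (Measure.pi fun i => (volume : Measure (FamE k i))).withDensity
            fun p => ENNReal.ofReal (Real.exp (-famKinetic p)) := Measure.restrict_le_self
  refine Measure.le_iff'.2 fun A => ?_
  have hA := Measure.le_iff'.1 hinner A
  simp only [Measure.smul_apply, smul_eq_mul] at hA ⊢
  exact mul_le_mul' le_rfl hA

/-- **The energy window of one leapfrog step**: for momenta in the box `‖p_i‖ ≤ R`, a force bounded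
by `b` and an action bounded by `s`, `H(Ψ(x, p)) ≤ H(x, p) + 2s + |ι|(R + |δ|b)²/2`. -/
theorem famLeapfrog_energy_window {b : ℝ} (hb : ∀ x i, ‖F x i‖ ≤ b)
    {S : (Π i, FamS k i) → ℝ} {s : ℝ} (hs : ∀ x, |S x| ≤ s) {R : ℝ}
    (x : Π i, FamS k i) {p : Π i, FamE k i} (hp : ∀ i, ‖p i‖ ≤ R) :
    (fun z : (Π i, FamS k i) × (Π i, FamE k i) => S z.1 + famKinetic z.2) (famProposal F δ 1 (x, p)) ≤
      (fun z : (Π i, FamS k i) × (Π i, FamE k i) => S z.1 + famKinetic z.2) (x, p) +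
        (2 * s + Fintype.card ι * (R + |δ| * b) ^ 2 / 2) := by
  have h1 : S (famProposal F δ 1 (x, p)).1 ≤ s := (abs_le.1 (hs _)).2
  have h2 : -s ≤ S x := (abs_le.1 (hs x)).1
  have h3 : 0 ≤ famKinetic p := famKinetic_nonneg p
  have h4 : famKinetic (famProposal F δ 1 (x, p)).2 ≤ Fintype.card ι * (R + |δ| * b) ^ 2 / 2 :=
    famKinetic_le_of_norm_le fun i =>
      (norm_snd_famProposal_one_le hb δ x p i).trans (add_le_add (hp i) le_rfl)
  change S (famProposal F δ 1 (x, p)).1 + famKinetic (famProposal F δ 1 (x, p)).2 ≤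
    S x + famKinetic p + (2 * s + Fintype.card ι * (R + |δ| * b) ^ 2 / 2)
  linarith

/-- **The proposed configuration from box-uniform momenta dominates `(∏ᵢ cᵢ) •` the product of the
uniform laws, uniformly in the configuration** (index by index by part 2b, then `smul_pi_le_pi`;
box radius `R = π/δ + δb/2 + 1`). -/
theorem smul_pi_uniformSphere_le_map_famProposal (hδ : 0 < δ) {b : ℝ} (hb0 : 0 ≤ b)
    (hb : ∀ x i, ‖F x i‖ ≤ b) (x : Π i, FamS k i) :
    (∏ i, sphereExpConst (k i) δ) • Measure.pi (fun i => uniformSphere (volume : Measure (FamE k i))) ≤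
      ((Measure.pi fun i => (volume : Measure (FamE k i))).restrict
          (famMomBox k (π / δ + δ / 2 * b + 1))).map
        fun p => (famProposal F δ 1 (x, p)).1 := by
  classical
  haveI hfin : ∀ i, IsFiniteMeasure ((volume : Measure (FamE k i)).restrict
      (ball (0 : FamE k i) (π / δ + δ / 2 * b + 1))) :=
    fun i => ⟨by rw [Measure.restrict_apply_univ]; exact measure_ball_lt_top⟩
  have hg : ∀ i, Measurable fun q : FamE k i => spherePos δ (x i) (q + (δ / 2) • F x i) :=
    fun i => (measurable_spherePos_right δ (x i)).comp (measurable_add_const _)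
  have hfun : (fun p : Π i, FamE k i => (famProposal F δ 1 (x, p)).1) =
      fun p i => (fun (i : ι) (q : FamE k i) => spherePos δ (x i) (q + (δ / 2) • F x i)) i (p i) := by
    funext p i
    exact fst_famProposal_one F δ x p i
  rw [hfun, famMomBox, Measure.restrict_pi_pi, Measure.pi_map_pi (fun i => (hg i).aemeasurable)]
  refine smul_pi_le_pi fun i => ?_
  refine smul_uniformSphere_le_map_spherePos (k i) hδ (b := δ / 2 * b) (by positivity) (x i) ?_
  rw [norm_smul, Real.norm_eq_abs, abs_of_pos (by positivity)]
  exact mul_le_mul_of_nonneg_left (hb x i) (by positivity)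

/-- **DOEBLIN FOR SINGLE-STEP GEODESIC LEAPFROG HMC ON A FAMILY OF SPHERES.**  For every step
`δ > 0`, measurable coupled force bounded by `b ≥ 0` and measurable action bounded by `s`, there is
`η > 0` with `K(x, ·) ≥ η • ⊗ uniformSphere` from EVERY configuration `x` — in ONE step. -/
theorem famLeapfrogHMC_minorised (hδ : 0 < δ) (hF : Measurable F) {b : ℝ} (hb0 : 0 ≤ b)
    (hb : ∀ x i, ‖F x i‖ ≤ b) {S : (Π i, FamS k i) → ℝ} (hS : Measurable S) {s : ℝ}
    (hs : ∀ x, |S x| ≤ s) :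
    ∃ η : ℝ≥0∞, 0 < η ∧ ∀ x,
      η • Measure.pi (fun i => uniformSphere (volume : Measure (FamE k i))) ≤ famLeapfrogHMC F δ 1 hF S x := by
  classical
  set R : ℝ := π / δ + δ / 2 * b + 1 with hR
  set c : ℝ≥0∞ := (famMomentumWeight k univ)⁻¹ *
    ENNReal.ofReal (Real.exp (-(Fintype.card ι * R ^ 2 / 2))) with hc
  set B : ℝ := 2 * s + Fintype.card ι * (R + |δ| * b) ^ 2 / 2 with hB
  set θ : ℝ≥0∞ := ∏ i, sphereExpConst (k i) δ with hθ
  have hH : Measurable fun z : (Π i, FamS k i) × (Π i, FamE k i) => S z.1 + famKinetic z.2 :=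
    (hS.comp measurable_fst).add (measurable_famKinetic.comp measurable_snd)
  have hs0 : 0 ≤ s := (abs_nonneg _).trans (hs fun i => sphereDefault)
  have hB0 : 0 ≤ B := by positivity
  refine ⟨ENNReal.ofReal (Real.exp (-B)) * (c * θ), ?_, fun x => ?_⟩
  · refine ENNReal.mul_pos (ENNReal.ofReal_pos.2 (Real.exp_pos _)).ne' (mul_ne_zero (mul_ne_zero ?_ ?_) ?_)
    · exact ENNReal.inv_ne_zero.2 famMomentumWeight_univ_ne_zero_ne_top.2
    · exact (ENNReal.ofReal_pos.2 (Real.exp_pos _)).ne'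
    · exact Finset.prod_ne_zero_iff.2 fun i _ => sphereExpConst_ne_zero (k i) δ
  · refine refreshUpdate_involMH_minorised (measurable_famProposal hF δ 1) hH (famMomentumLaw k)
      (ρ := c • (Measure.pi fun i => (volume : Measure (FamE k i))).restrict (famMomBox k R))
      (smul_restrict_famMomBox_le_famMomentumLaw R)
      (fun v => Measure.ae_smul_measure ((ae_restrict_iff' (measurableSet_famMomBox R)).2
        (Filter.Eventually.of_forall fun p hp => le_involAcceptE_of_le hB0
          (famLeapfrog_energy_window hb hs v (norm_le_of_mem_famMomBox hp)))) _)
      (fun v => ?_) x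
    rw [Measure.map_smul, mul_smul]
    refine Measure.le_iff'.2 fun A => ?_
    have hA := Measure.le_iff'.1 (smul_pi_uniformSphere_le_map_famProposal hδ hb0 hb v) A
    simp only [Measure.smul_apply, smul_eq_mul] at hA ⊢
    exact mul_le_mul' le_rfl hA

/-! ## §3 Uniform ergodicity: convergence to the Gibbs law from every start, uniqueness -/

/-- The Gibbs weight of a bounded measurable action has finite non-zero mass:
`e^{−s} ≤ Z_S ≤ e^{s}`. -/
theorem famGibbsWeight_univ_ne {S : (Π i, FamS k i) → ℝ} {s : ℝ} (hs : ∀ x, |S x| ≤ s) :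
    ((Measure.pi fun i => uniformSphere (volume : Measure (FamE k i))).withDensity
        fun x => ENNReal.ofReal (Real.exp (-S x))) univ ≠ 0 ∧
    ((Measure.pi fun i => uniformSphere (volume : Measure (FamE k i))).withDensity
        fun x => ENNReal.ofReal (Real.exp (-S x))) univ ≠ ⊤ := by
  rw [withDensity_apply _ MeasurableSet.univ, Measure.restrict_univ]
  constructor
  · intro h0
    have hle : ∫⁻ _x : Π i, FamS k i, ENNReal.ofReal (Real.exp (-s))
        ∂(Measure.pi fun i => uniformSphere (volume : Measure (FamE k i))) ≤ 0 := by
      rw [← h0]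
      exact lintegral_mono fun x => ENNReal.ofReal_le_ofReal (Real.exp_le_exp.2 (by
        have := (abs_le.1 (hs x)).2; linarith))
    rw [MeasureTheory.lintegral_const, measure_univ, mul_one, nonpos_iff_eq_zero, ENNReal.ofReal_eq_zero] at hle
    exact absurd hle (not_le.2 (Real.exp_pos _))
  · refine ne_top_of_le_ne_top (ENNReal.ofReal_ne_top (r := Real.exp s)) ?_
    calc ∫⁻ x, ENNReal.ofReal (Real.exp (-S x))
          ∂(Measure.pi fun i => uniformSphere (volume : Measure (FamE k i)))
        ≤ ∫⁻ _x, ENNReal.ofReal (Real.exp s)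
            ∂(Measure.pi fun i => uniformSphere (volume : Measure (FamE k i))) :=
          lintegral_mono fun x => ENNReal.ofReal_le_ofReal (Real.exp_le_exp.2 (by
            have := (abs_le.1 (hs x)).1; linarith))
      _ = ENNReal.ofReal (Real.exp s) := by rw [MeasureTheory.lintegral_const, measure_univ, mul_one]

/-- The Gibbs law of a bounded measurable action is a probability law. -/
theorem isProbabilityMeasure_famGibbsLaw {S : (Π i, FamS k i) → ℝ} {s : ℝ} (hs : ∀ x, |S x| ≤ s) :
    IsProbabilityMeasure (famGibbsLaw (k := k) S) :=
  ⟨by rw [famGibbsLaw, Measure.smul_apply, smul_eq_mul,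
    ENNReal.inv_mul_cancel (famGibbsWeight_univ_ne hs).1 (famGibbsWeight_univ_ne hs).2]⟩

/-- **SINGLE-STEP GEODESIC LEAPFROG HMC ON A FAMILY OF SPHERES IS UNIFORMLY ERGODIC.**  For every
step `δ > 0`, measurable coupled force bounded by `b ≥ 0`, measurable action bounded by `s`: there is
`η ∈ (0, 1]` such that for EVERY initial law `μ₀`, every `t` and every set `A`,
`|μ₀Kᵗ(A) − π_S(A)| ≤ (1 − η)ᵗ`, `π_S = Z_S⁻¹ e^{−S} · ⊗ uniformSphere`. -/
theorem famLeapfrogHMC_uniformlyErgodic (hδ : 0 < δ) (hF : Measurable F) {b : ℝ} (hb0 : 0 ≤ b)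
    (hb : ∀ x i, ‖F x i‖ ≤ b) {S : (Π i, FamS k i) → ℝ} (hS : Measurable S) {s : ℝ}
    (hs : ∀ x, |S x| ≤ s) :
    ∃ η : ℝ, 0 < η ∧ η ≤ 1 ∧ ∀ (μ₀ : Measure (Π i, FamS k i)) [IsProbabilityMeasure μ₀] (t : ℕ)
      (A : Set (Π i, FamS k i)),
      |((fun m : Measure (Π i, FamS k i) => m.bind (famLeapfrogHMC F δ 1 hF S))^[t] μ₀).real A
          - (famGibbsLaw S).real A| ≤ (1 - η) ^ t := by
  haveI := isProbabilityMeasure_famGibbsLaw (k := k) hs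
  obtain ⟨η, hη0, hmin⟩ := famLeapfrogHMC_minorised hδ hF hb0 hb hS hs
  have hH : Measurable fun z : (Π i, FamS k i) × (Π i, FamE k i) => S z.1 + famKinetic z.2 :=
    (hS.comp measurable_fst).add (measurable_famKinetic.comp measurable_snd)
  haveI : Fact (Measurable S) := ⟨hS⟩
  have hη1 : η ≤ 1 := by
    have h := Measure.le_iff'.1 (hmin fun _ => sphereDefault) univ
    rwa [Measure.smul_apply, smul_eq_mul, measure_univ, measure_univ, mul_one] at h
  have hηtop : η ≠ ⊤ := ne_top_of_le_ne_top ENNReal.one_ne_top hη1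
  refine ⟨η.toReal, ENNReal.toReal_pos hη0.ne' hηtop,
    ENNReal.toReal_le_of_le_ofReal zero_le_one (by rwa [ENNReal.ofReal_one]), fun μ₀ _ t A => ?_⟩
  exact refreshUpdate_involMH_uniformlyErgodic (measurable_famProposal hF δ 1) hH (famMomentumLaw k)
    hmin (famLeapfrogHMC_invariant_gibbsLaw hF δ 1 hS) μ₀ t A

/-- **The Gibbs law is the unique invariant probability law** of single-step geodesic leapfrog HMC
on the family of spheres (bounded measurable force and action, `δ > 0`). -/
theorem famLeapfrogHMC_invariant_unique (hδ : 0 < δ) (hF : Measurable F) {b : ℝ} (hb0 : 0 ≤ b)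
    (hb : ∀ x i, ‖F x i‖ ≤ b) {S : (Π i, FamS k i) → ℝ} (hS : Measurable S) {s : ℝ}
    (hs : ∀ x, |S x| ≤ s) {π' : Measure (Π i, FamS k i)} [IsProbabilityMeasure π']
    (hπ' : Kernel.Invariant (famLeapfrogHMC F δ 1 hF S) π') : π' = famGibbsLaw S := by
  haveI := isProbabilityMeasure_famGibbsLaw (k := k) hs
  obtain ⟨η, hη0, hmin⟩ := famLeapfrogHMC_minorised hδ hF hb0 hb hS hs
  have hH : Measurable fun z : (Π i, FamS k i) × (Π i, FamE k i) => S z.1 + famKinetic z.2 :=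
    (hS.comp measurable_fst).add (measurable_famKinetic.comp measurable_snd)
  exact refreshUpdate_involMH_invariant_unique (measurable_famProposal hF δ 1) hH (famMomentumLaw k)
    hmin hη0 (famLeapfrogHMC_invariant_gibbsLaw hF δ 1 hS) hπ'

end Family

end Summit.Ventures.LatticeQCDFlow.Exactness

end
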